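import Mathlib
import Literature.Analysis.FluidPDE.GaussianVortexPlanar
import Literature.Analysis.FluidPDE.GaussianVortexPlanarProofs
import Summits.AnomalousDissipation.AnomalousDissipation.Theorems.MarginalStabilityChainStretchedVortexRowsStubCoreLEnergyGapMoment
import HarnessLib

/-!
# Helper `coreL_Y_control` toward stub `stub_coreInverse` of the line `braid-closed-large-circulation-gluing`
# (crux stmt-AnomalousDissipation-3009, `MarginalStabilityChain.StretchedVortexRows`)

Control of Gallay–Wayne's `Y`-norm `‖w‖²_Y = ∫ G⁻¹(w² + |∇w|²)` (`gwSobolevNormSq`) of a vorticity in ground-state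
form `w = G u`, `G = gaussVortexProfile = (4π)⁻¹e^{−|ξ|²/4}`, `u ∈ C¹(ℝ²)` with `u, Du` bounded, by the energy
quantities of the core operator:

  `‖G u‖²_Y ≤ 16 (∫ G ‖Du‖² + ∫ G u²)`      (`coreL_Y_control`).

Proof. `∇w = G ∇u + u ∇G = G(∇u − u ξ/2)` (`∇G = −(ξ/2)G`), so pointwise
`G⁻¹(w² + |∇w|²) ≤ G (u² + 2‖Du‖² + ½|ξ|²u²)`; with the Gaussian second-moment bound
`∫ |ξ|² u² G ≤ 16 ∫ G‖Du‖² + 8 ∫ G u²` of the helper module `…StubCoreLEnergyGapMoment` this gives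
`‖w‖²_Y ≤ 10∫G‖Du‖² + 5∫Gu²`. The `Y`-integrand is continuous and dominated, hence integrable (no junk value).

References: Th. Gallay, C. E. Wayne, J. Math. Fluid Mech. 9 (2007), (1.9) (the space `Y`); Th. Gallay, Y. Maekawa,
arXiv:1610.08384, §4.1.
-/

set_option linter.dupNamespace false

noncomputable section

open scoped RealInnerProductSpace Topology
open MeasureTheory WithLp Function Filter

namespace Summit.AnomalousDissipation.AnomalousDissipation.Theorems.MarginalStabilityChainStretchedVortexRows

open Literature.Analysis.FluidPDE Literature.Analysis.UnboundedOperators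

/-- `‖DG(ξ)‖ ≤ (G(ξ)/2) |ξ|` (from `DG(ξ)[v] = −(G(ξ)/2)⟪ξ, v⟫`; private copy of the lemma of
`…StubCoreRotationLocalSkew`). [folklore] -/
private theorem norm_fderiv_gauss_le (ξ : EuclideanSpace ℝ (Fin 2)) :
    ‖fderiv ℝ gaussVortexProfile ξ‖ ≤ gaussVortexProfile ξ / 2 * ‖ξ‖ := by
  refine ContinuousLinearMap.opNorm_le_bound _ (by positivity [gaussVortexProfile_pos ξ]) fun v => ?_
  rw [fderiv_gaussVortexProfile_apply, Real.norm_eq_abs, abs_mul, abs_neg,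
    abs_of_pos (by positivity [gaussVortexProfile_pos ξ])]
  rw [mul_assoc]
  exact mul_le_mul_of_nonneg_left (abs_real_inner_le_norm ξ v) (by positivity [gaussVortexProfile_pos ξ])

/-! ### `Y`-control of `w = G u` -/

section YControl

variable {u : EuclideanSpace ℝ (Fin 2) → ℝ} (hu : ContDiff ℝ 1 u) {M : ℝ}
  (h0 : ∀ x, |u x| ≤ M) (h1 : ∀ x, ‖fderiv ℝ u x‖ ≤ M)
include hu

/-- **Pointwise bound of the `Y`-integrand of `w = G u`**: `∇w = G ∇u + u ∇G` with `‖∇G‖ ≤ (G/2)|ξ|`, so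
`G⁻¹(w² + ‖∇w‖²) ≤ G u² + 2 G‖Du‖² + ½ |ξ|² u² G`. [folklore] -/
theorem gwSobolev_integrand_gaussVortexProfile_mul_le (x : EuclideanSpace ℝ (Fin 2)) :
    (gaussVortexProfile x)⁻¹ * ((gaussVortexProfile x * u x) ^ 2 +
        ‖gradient (fun η => gaussVortexProfile η * u η) x‖ ^ 2) ≤
      gaussVortexProfile x * u x ^ 2 + 2 * (gaussVortexProfile x * ‖fderiv ℝ u x‖ ^ 2) +
        (1 / 2 : ℝ) * (‖x‖ ^ 2 * u x ^ 2 * gaussVortexProfile x) := by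
  have hGx := gaussVortexProfile_pos x
  have hGd : HasFDerivAt gaussVortexProfile (fderiv ℝ gaussVortexProfile x) x :=
    ((contDiff_gaussVortexProfile (n := 1)).differentiable one_ne_zero x).hasFDerivAt
  have hud : HasFDerivAt u (fderiv ℝ u x) x := (hu.differentiable one_ne_zero x).hasFDerivAt
  -- the derivative of `w = G u` and its norm
  have hwd : HasFDerivAt (fun η => gaussVortexProfile η * u η)
      (gaussVortexProfile x • fderiv ℝ u x + u x • fderiv ℝ gaussVortexProfile x) x := hGd.fun_mul hud
  have hnorm : ‖fderiv ℝ (fun η => gaussVortexProfile η * u η) x‖ ≤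
      gaussVortexProfile x * (‖fderiv ℝ u x‖ + |u x| * ‖x‖ / 2) := by
    rw [hwd.fderiv]
    calc ‖gaussVortexProfile x • fderiv ℝ u x + u x • fderiv ℝ gaussVortexProfile x‖
        ≤ ‖gaussVortexProfile x • fderiv ℝ u x‖ + ‖u x • fderiv ℝ gaussVortexProfile x‖ := norm_add_le _ _
      _ = gaussVortexProfile x * ‖fderiv ℝ u x‖ + |u x| * ‖fderiv ℝ gaussVortexProfile x‖ := by
          rw [norm_smul, norm_smul, Real.norm_of_nonneg hGx.le, Real.norm_eq_abs]
      _ ≤ gaussVortexProfile x * ‖fderiv ℝ u x‖ + |u x| * (gaussVortexProfile x / 2 * ‖x‖) := by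
          have := mul_le_mul_of_nonneg_left (norm_fderiv_gauss_le x) (abs_nonneg (u x))
          linarith
      _ = gaussVortexProfile x * (‖fderiv ℝ u x‖ + |u x| * ‖x‖ / 2) := by ring
  have hg : ‖gradient (fun η => gaussVortexProfile η * u η) x‖ =
      ‖fderiv ℝ (fun η => gaussVortexProfile η * u η) x‖ := by
    rw [gradient, LinearIsometryEquiv.norm_map]
  have hsq : ‖gradient (fun η => gaussVortexProfile η * u η) x‖ ^ 2 ≤
      (gaussVortexProfile x * (‖fderiv ℝ u x‖ + |u x| * ‖x‖ / 2)) ^ 2 := by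
    rw [hg]; exact pow_le_pow_left₀ (norm_nonneg _) hnorm 2
  calc (gaussVortexProfile x)⁻¹ * ((gaussVortexProfile x * u x) ^ 2 +
        ‖gradient (fun η => gaussVortexProfile η * u η) x‖ ^ 2)
      ≤ (gaussVortexProfile x)⁻¹ * ((gaussVortexProfile x * u x) ^ 2 +
          (gaussVortexProfile x * (‖fderiv ℝ u x‖ + |u x| * ‖x‖ / 2)) ^ 2) :=
        mul_le_mul_of_nonneg_left ((add_le_add_iff_left _).2 hsq) (inv_nonneg.2 hGx.le)
    _ = gaussVortexProfile x * (u x ^ 2 + (‖fderiv ℝ u x‖ + |u x| * ‖x‖ / 2) ^ 2) := by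
        field_simp
    _ ≤ gaussVortexProfile x * (u x ^ 2 + (2 * ‖fderiv ℝ u x‖ ^ 2 + 2 * (|u x| * ‖x‖ / 2) ^ 2)) := by
        gcongr
        nlinarith [sq_nonneg (‖fderiv ℝ u x‖ - |u x| * ‖x‖ / 2)]
    _ = _ := by rw [div_pow, mul_pow, sq_abs]; ring

include h0 h1 in
/-- The dominating function `G u² + 2 G‖Du‖² + ½|ξ|²u²G` of the `Y`-integrand is integrable. [folklore] -/
theorem integrable_gwSobolev_dominator :
    Integrable fun x : EuclideanSpace ℝ (Fin 2) =>
      gaussVortexProfile x * u x ^ 2 + 2 * (gaussVortexProfile x * ‖fderiv ℝ u x‖ ^ 2) +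
        (1 / 2 : ℝ) * (‖x‖ ^ 2 * u x ^ 2 * gaussVortexProfile x) :=
  ((integrable_gauss_mul_sq hu h0).add ((integrable_gauss_mul_norm_fderiv_sq hu h1).const_mul _)).add
    ((integrable_norm_sq_mul_sq_mul_gauss hu h0).const_mul _)

include h0 h1 in
/-- **`w = G u ∈ Y`** for `u ∈ C¹(ℝ²)` with `u, Du` bounded: `w ∈ C¹` and the `Y`-integrand `G⁻¹(w² + ‖∇w‖²)` is
integrable (continuous and dominated by `G u² + 2G‖Du‖² + ½|ξ|²u²G`), so `gwSobolevNormSq w` is a genuine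
(non-junk) integral (Gallay–Wayne's space `Y`, (1.9)). [folklore] -/
theorem memGWSobolev_gaussVortexProfile_mul : MemGWSobolev (fun η => gaussVortexProfile η * u η) := by
  have hGc : Continuous gaussVortexProfile := (contDiff_gaussVortexProfile (n := 0)).continuous
  have hw1 : ContDiff ℝ 1 (fun η => gaussVortexProfile η * u η) := (contDiff_gaussVortexProfile (n := 1)).mul hu
  refine ⟨hw1, ?_⟩
  have hgradc : Continuous (gradient (fun η => gaussVortexProfile η * u η)) :=
    (InnerProductSpace.toDual ℝ (EuclideanSpace ℝ (Fin 2))).symm.continuous.comp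
      (hw1.continuous_fderiv one_ne_zero)
  have hFc : Continuous fun x => (gaussVortexProfile x)⁻¹ * ((gaussVortexProfile x * u x) ^ 2 +
      ‖gradient (fun η => gaussVortexProfile η * u η) x‖ ^ 2) :=
    (hGc.inv₀ fun x => (gaussVortexProfile_pos x).ne').mul
      (((hGc.mul hu.continuous).pow 2).add (hgradc.norm.pow 2))
  refine (integrable_gwSobolev_dominator hu h0 h1).mono' hFc.aestronglyMeasurable
    (Eventually.of_forall fun x => ?_)
  rw [Real.norm_of_nonneg (by positivity [gaussVortexProfile_pos x])]
  exact gwSobolev_integrand_gaussVortexProfile_mul_le hu x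

include h0 h1 in
/-- **`Y`-norm control in ground-state variables**: for `u ∈ C¹(ℝ²)` with `u, Du` bounded and `w = G u`,
`‖w‖²_Y = ∫ G⁻¹(w² + |∇w|²) ≤ 16 (∫ G‖Du‖² + ∫ G u²)`. Indeed `∇w = G(∇u − u ξ/2)`, so
`G⁻¹(w² + |∇w|²) ≤ G(u² + 2‖Du‖² + ½|ξ|²u²)`, and the Gaussian second-moment bound
`∫ |ξ|²u²G ≤ 16∫G‖Du‖² + 8∫Gu²` gives `‖w‖²_Y ≤ 10∫G‖Du‖² + 5∫Gu²`. [folklore] -/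
theorem gwSobolevNormSq_gaussVortexProfile_mul_le :
    gwSobolevNormSq (fun η => gaussVortexProfile η * u η) ≤
      16 * ((∫ ξ, gaussVortexProfile ξ * ‖fderiv ℝ u ξ‖ ^ 2) + ∫ ξ, gaussVortexProfile ξ * u ξ ^ 2) := by
  have hmom := integral_norm_sq_mul_sq_mul_gaussVortexProfile_le hu h0 h1
  have iM := integrable_norm_sq_mul_sq_mul_gauss hu h0
  have iA := integrable_gauss_mul_norm_fderiv_sq hu h1
  have iB := integrable_gauss_mul_sq hu h0
  have hA0 : 0 ≤ ∫ x, gaussVortexProfile x * ‖fderiv ℝ u x‖ ^ 2 :=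
    integral_nonneg fun x => by positivity [gaussVortexProfile_pos x]
  have hB0 : 0 ≤ ∫ x, gaussVortexProfile x * u x ^ 2 :=
    integral_nonneg fun x => by positivity [gaussVortexProfile_pos x]
  have iBA : Integrable fun x : EuclideanSpace ℝ (Fin 2) =>
      gaussVortexProfile x * u x ^ 2 + 2 * (gaussVortexProfile x * ‖fderiv ℝ u x‖ ^ 2) :=
    iB.add (iA.const_mul _)
  have hmono := integral_mono (memGWSobolev_gaussVortexProfile_mul hu h0 h1).2
    (integrable_gwSobolev_dominator hu h0 h1) (gwSobolev_integrand_gaussVortexProfile_mul_le hu)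
  rw [integral_add iBA (iM.const_mul _), integral_add iB (iA.const_mul _),
    integral_const_mul, integral_const_mul] at hmono
  change ∫ x, (gaussVortexProfile x)⁻¹ * ((gaussVortexProfile x * u x) ^ 2 +
      ‖gradient (fun η => gaussVortexProfile η * u η) x‖ ^ 2) ≤ _
  linarith

end YControl

/-- **`Y`-control of `w = G u`** (registered helper toward `stub_coreInverse`): for `u ∈ C¹(ℝ²)` with `u, Du`
bounded, `‖G u‖²_Y = gwSobolevNormSq (G u) ≤ 16 (∫ G ‖Du‖² + ∫ G u²)` (Gallay–Wayne's space `Y`, (1.9)). [folklore] -/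
theorem coreL_Y_control :
    ∀ u : EuclideanSpace ℝ (Fin 2) → ℝ, ContDiff ℝ 1 u →
      (∃ M : ℝ, ∀ ξ, |u ξ| ≤ M ∧ ‖fderiv ℝ u ξ‖ ≤ M) →
      gwSobolevNormSq (fun η => gaussVortexProfile η * u η) ≤
        16 * ((∫ ξ, gaussVortexProfile ξ * ‖fderiv ℝ u ξ‖ ^ 2) + ∫ ξ, gaussVortexProfile ξ * u ξ ^ 2) := by
  intro u hu hM
  obtain ⟨M, hM⟩ := hM
  exact gwSobolevNormSq_gaussVortexProfile_mul_le hu (fun x => (hM x).1) fun x => (hM x).2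

end Summit.AnomalousDissipation.AnomalousDissipation.Theorems.MarginalStabilityChainStretchedVortexRows

end
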